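import Summits.SmoothPoincare4.SmoothPoincare4.Theorems.EuclideanOrigamiRoundCreaseStandardCrease
import Literature.Topology.FourManifolds.PuncturedHomotopySphere
import Literature.Topology.FourManifolds.AnnulusPairConnectivity
import Literature.Topology.FourManifolds.CerfGammaFourProofs
import Mathlib.Analysis.Convex.Contractible

/-!
# Sheet counting for a round crease: `F` is injective on the fake ball

Helper file (2/2) for the support item `RoundCreaseStandard` of route EuclideanOrigami
(stmt-SmoothPoincare4-10644; shared verbatim with the registered stub `stub_roundCreaseStandard`
of line `round-trace-continuity`, crux `OrigamiFoldExistence`, stmt-SmoothPoincare4-7844). This is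
the round-crease instance of the route's `CoveringLemma` (stmt-SmoothPoincare4-7482), proved here
outright; everything is proved, no definitions, no named facts.

Setting as in `EuclideanOrigamiRoundCreaseStandardCrease.lean`: `(e, F)` an immersed fake ball of a
homotopy 4-sphere `S` with round crease `dist (F (e u)) c = r` (`‖u‖ = 1`); write
`Δ = (e(B̊⁴))ᶜ` (compact), `Δ° = (e(B̄⁴))ᶜ` (open), `∂ = e(S³)`. We prove:

* `image_compl_ball_subset_closedBall`: `F(Δ) ⊆ B̄_r(c)` — a point of the compact `F(Δ)` farthest
  from `c` at distance `> r` is the image of a point of `Δ°`, near which `F(Δ) ⊇ F(Δ°)` is a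
  neighbourhood (`F(Δ°)` is open, `F` being a local homeomorphism on `Δ°`), containing points still
  farther from `c`;
* `image_compl_image_closedBall_eq`: `F(Δ°) = B_r(c)` — open, relatively closed in the connected
  open ball, nonempty;
* `isPreconnected_compl_image_closedBall`: `Δ°` is connected — the union of `(e(B(0,2)))ᶜ`
  (complement of the unit ball of the rescaled chart `y ↦ e (2y)`, tree
  `HomotopySphere.isPathConnected_compl_image_ball`) and `e({‖y‖ > 1})`, meeting at `e (3u₀)`;
* `injOn_compl_image_closedBall`, **sheet counting**: the restriction `Δ° → B_r(c)` of `F` is a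
  proper local homeomorphism with finite fibres, hence a covering map (Mathlib
  `IsClosedMap.isCoveringMapOn_of_isLocalHomeomorphOn`), of the simply connected ball by a
  connected space, hence injective (lifting criterion);
* `injOn_compl_image_ball`, `image_compl_image_ball_eq`: `F` is injective on all of `Δ` and
  `F(Δ) = B̄_r(c)` (boundary points go to the round sphere, on which `F ∘ e` is injective by
  `injOn_comp_sphere`).

References: A. Hatcher, *Algebraic Topology* (2002), §1.3 (covering spaces, Props. 1.33–1.34)
[HatcherAT2002]; M. Brown, *A proof of the generalized Schoenflies theorem*, Bull. AMS 66 (1960)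
(context: the route's `CoveringLemma`) [Brown1960]; M. W. Hirsch, *Differential Topology* (1976),
Ch. 2 §1 [HirschDT1976].
-/

noncomputable section

-- the prescribed namespace `Summit.<P>.<Sub>.…` duplicates `SmoothPoincare4` (P = Sub)
set_option linter.dupNamespace false

open scoped Manifold ContDiff Topology
open Set Function Metric
open Literature.Topology.FourManifolds (HomotopySphere)

namespace Summit.SmoothPoincare4.SmoothPoincare4.Theorems.EuclideanOrigami.RoundCreaseStandard

variable (S : HomotopySphere 4) {e : EuclideanSpace ℝ (Fin 4) → S.carrier} {F : S.carrier →
    (EuclideanSpace ℝ (Fin 4))}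

/-- `F((e(B̄⁴))ᶜ)` is open (`F` is a local homeomorphism on this open set). -/
theorem isOpen_image_compl_closedBall (hE : Manifold.IsSmoothEmbedding (𝓡 4) (𝓡 4) ∞ e)
    (hF : ∀ x, x ∉ e '' ball (0 : EuclideanSpace ℝ (Fin 4)) 1 → IsLocalDiffeomorphAt (𝓡 4) (𝓡 4) ∞
        F x) :
    IsOpen (F '' (e '' closedBall (0 : EuclideanSpace ℝ (Fin 4)) 1)ᶜ) := by
  rw [isOpen_iff_forall_mem_open]
  rintro _ ⟨x, hx, rfl⟩
  obtain ⟨Φ, hxΦ, heq⟩ := hF x (compl_image_closedBall_subset S hx)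
  refine ⟨Φ '' (Φ.source ∩ (e '' closedBall (0 : EuclideanSpace ℝ (Fin 4)) 1)ᶜ), ?_, ?_, ⟨x, ⟨hxΦ,
      hx⟩, (heq hxΦ).symm⟩⟩
  · rintro _ ⟨y, ⟨hyΦ, hy⟩, rfl⟩
    exact ⟨y, hy, heq hyΦ⟩
  · exact Φ.toOpenPartialHomeomorph.isOpen_image_of_subset_source
      (Φ.open_source.inter (isClosed_image_closedBall S hE).isOpen_compl) inter_subset_left

/-- **`F(Δ_e) ⊆ B̄_r(c)`**: a point of the compact `F(Δ_e)` farthest from `c` at distance `> r` would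
be the image of an interior point of `Δ_e`, near which `F(Δ_e)` is a neighbourhood containing points
still farther from `c`. -/
theorem image_compl_ball_subset_closedBall (hE : Manifold.IsSmoothEmbedding (𝓡 4) (𝓡 4) ∞ e)
    (hF : ∀ x, x ∉ e '' ball (0 : EuclideanSpace ℝ (Fin 4)) 1 → IsLocalDiffeomorphAt (𝓡 4) (𝓡 4) ∞
        F x)
    {c : EuclideanSpace ℝ (Fin 4)} {r : ℝ} (hr : 0 < r) (hround : ∀ u : EuclideanSpace ℝ (Fin 4),
        ‖u‖ = 1 → dist (F (e u)) c = r) :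
    F '' (e '' ball (0 : EuclideanSpace ℝ (Fin 4)) 1)ᶜ ⊆ closedBall c r := by
  set Δ := (e '' ball (0 : EuclideanSpace ℝ (Fin 4)) 1)ᶜ with hΔ
  have hΔc : IsCompact Δ := (isOpen_image_ball S hE).isClosed_compl.isCompact
  have hKc : IsCompact (F '' Δ) := hΔc.image_of_continuousOn (continuousOn_compl_image_ball S hF)
  have hne : (F '' Δ).Nonempty :=
    ⟨F (e (EuclideanSpace.single 0 1)),
      mem_image_of_mem _ (image_sphere_subset S hE ⟨_, by simp, rfl⟩)⟩
  obtain ⟨y₀, hy₀, hmax⟩ :=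
    hKc.exists_isMaxOn hne (continuous_id'.dist continuous_const).continuousOn
  intro y hy
  rw [mem_closedBall]
  refine le_trans (isMaxOn_iff.1 hmax y hy) ?_
  show dist y₀ c ≤ r
  rcases le_or_gt (dist y₀ c) r with hle | hlt
  · exact hle
  exfalso
  obtain ⟨x₀, hx₀, rfl⟩ := hy₀
  have hx₀' : x₀ ∈ (e '' closedBall (0 : EuclideanSpace ℝ (Fin 4)) 1)ᶜ := by
    rcases mem_compl_image_ball S hx₀ with h | ⟨u, hu, rfl⟩
    · exact h
    · exact absurd (hround u (mem_sphere_zero_iff_norm.1 hu)) hlt.ne'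
  obtain ⟨ε, hε, hball⟩ := Metric.isOpen_iff.1 (isOpen_image_compl_closedBall S hE hF) (F x₀)
    (mem_image_of_mem _ hx₀')
  set d := dist (F x₀) c with hd
  have hdpos : 0 < d := hr.trans hlt
  set t : ℝ := ε / (2 * d) with ht
  have htpos : 0 < t := div_pos hε (by positivity)
  have htd : t * d = ε / 2 := by
    rw [ht]
    field_simp
  set y₁ : EuclideanSpace ℝ (Fin 4) := F x₀ + t • (F x₀ - c) with hy₁
  have hy₁ball : y₁ ∈ ball (F x₀) ε := by
    rw [mem_ball, hy₁, dist_eq_norm, add_sub_cancel_left, norm_smul, Real.norm_of_nonneg htpos.le,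
      ← dist_eq_norm, ← hd, htd]
    linarith
  have hy₁dist : dist y₁ c = (1 + t) * d := by
    have : y₁ - c = (1 + t) • (F x₀ - c) := by
      rw [hy₁, add_smul, one_smul]
      abel
    rw [dist_eq_norm, this, norm_smul, Real.norm_of_nonneg (by positivity), ← dist_eq_norm]
  have hy₁mem : y₁ ∈ F '' Δ := image_mono (compl_image_closedBall_subset S) (hball hy₁ball)
  have h : dist y₁ c ≤ dist (F x₀) c := isMaxOn_iff.1 hmax y₁ hy₁mem
  rw [hy₁dist, ← hd] at h
  nlinarith

/-- **`F((e(B̄⁴))ᶜ) ⊆ B_r(c)`**: an open subset of the closed ball lies in the open ball. -/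
theorem image_compl_closedBall_subset_ball (hE : Manifold.IsSmoothEmbedding (𝓡 4) (𝓡 4) ∞ e)
    (hF : ∀ x, x ∉ e '' ball (0 : EuclideanSpace ℝ (Fin 4)) 1 → IsLocalDiffeomorphAt (𝓡 4) (𝓡 4) ∞
        F x)
    {c : EuclideanSpace ℝ (Fin 4)} {r : ℝ} (hr : 0 < r) (hround : ∀ u : EuclideanSpace ℝ (Fin 4),
        ‖u‖ = 1 → dist (F (e u)) c = r) :
    F '' (e '' closedBall (0 : EuclideanSpace ℝ (Fin 4)) 1)ᶜ ⊆ ball c r := by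
  rw [← interior_closedBall c hr.ne', (isOpen_image_compl_closedBall S hE hF).subset_interior_iff]
  exact (image_mono (compl_image_closedBall_subset S)).trans
    (image_compl_ball_subset_closedBall S hE hF hr hround)

/-- **`B_r(c) ⊆ F((e(B̄⁴))ᶜ)`**: `F((e(B̄⁴))ᶜ)` is open, closed in the open ball (it is the trace of
the compact `F(Δ_e)`), nonempty, and the ball is connected. -/
theorem ball_subset_image_compl_closedBall (hE : Manifold.IsSmoothEmbedding (𝓡 4) (𝓡 4) ∞ e)
    (hF : ∀ x, x ∉ e '' ball (0 : EuclideanSpace ℝ (Fin 4)) 1 → IsLocalDiffeomorphAt (𝓡 4) (𝓡 4) ∞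
        F x)
    {c : EuclideanSpace ℝ (Fin 4)} {r : ℝ} (hr : 0 < r) (hround : ∀ u : EuclideanSpace ℝ (Fin 4),
        ‖u‖ = 1 → dist (F (e u)) c = r) :
    ball c r ⊆ F '' (e '' closedBall (0 : EuclideanSpace ℝ (Fin 4)) 1)ᶜ := by
  have hΔc : IsCompact (e '' ball (0 : EuclideanSpace ℝ (Fin 4)) 1)ᶜ := (isOpen_image_ball S
      hE).isClosed_compl.isCompact
  have hKclosed : IsClosed (F '' (e '' ball (0 : EuclideanSpace ℝ (Fin 4)) 1)ᶜ) :=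
    (hΔc.image_of_continuousOn (continuousOn_compl_image_ball S hF)).isClosed
  refine (convex_ball c r).isPreconnected.subset_left_of_subset_union
    (isOpen_image_compl_closedBall S hE hF) hKclosed.isOpen_compl ?_ ?_ ?_
  · exact disjoint_compl_right.mono_left (image_mono (compl_image_closedBall_subset S))
  · intro y hy
    by_cases h : y ∈ F '' (e '' ball (0 : EuclideanSpace ℝ (Fin 4)) 1)ᶜ
    · obtain ⟨x, hx, rfl⟩ := h
      left
      rcases mem_compl_image_ball S hx with h' | ⟨u, hu, rfl⟩
      · exact mem_image_of_mem F h'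
      · exact absurd (hround u (mem_sphere_zero_iff_norm.1 hu)) (mem_ball.1 hy).ne
    · exact Or.inr h
  · have hx : e ((2 : ℝ) • EuclideanSpace.single 0 1) ∈ (e '' closedBall (0 : EuclideanSpace ℝ
      (Fin 4)) 1)ᶜ := by
      rintro ⟨v, hv, hve⟩
      rw [hE.isEmbedding.injective hve, mem_closedBall_zero_iff, norm_smul] at hv
      norm_num at hv
    exact ⟨_, image_compl_closedBall_subset_ball S hE hF hr hround (mem_image_of_mem F hx),
      mem_image_of_mem F hx⟩

/-- **`(e(B̄⁴))ᶜ` is connected**: it is the union of `(e(B(0,2)))ᶜ` — the complement of the unit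
ball of the rescaled chart `y ↦ e (2y)`, path connected by the tree's
`HomotopySphere.isPathConnected_compl_image_ball` — and of `e({‖y‖ > 1})`, which meet at `e (3u₀)`. -/
theorem isPreconnected_compl_image_closedBall (hE : Manifold.IsSmoothEmbedding (𝓡 4) (𝓡 4) ∞ e) :
    IsPreconnected (e '' closedBall (0 : EuclideanSpace ℝ (Fin 4)) 1)ᶜ := by
  let D : (EuclideanSpace ℝ (Fin 4)) ≃ₘ⟮𝓡 4, 𝓡 4⟯ (EuclideanSpace ℝ (Fin 4)) :=
    { toFun := fun y => (2 : ℝ) • y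
      invFun := fun y => (2 : ℝ)⁻¹ • y
      left_inv := fun y => by simp [smul_smul]
      right_inv := fun y => by simp [smul_smul]
      contMDiff_toFun := (contDiff_const_smul (2 : ℝ)).contMDiff
      contMDiff_invFun := (contDiff_const_smul (2 : ℝ)⁻¹).contMDiff }
  have hE2 : Manifold.IsSmoothEmbedding (𝓡 4) (𝓡 4) ∞ (e ∘ D) := hE.comp_diffeomorph D
  have h2 : IsPathConnected ((e ∘ D) '' ball (0 : EuclideanSpace ℝ (Fin 4)) 1)ᶜ :=
    Literature.Topology.FourManifolds.HomotopySphere.isPathConnected_compl_image_ball S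
      (by norm_num) hE2
  have himage : (e ∘ D) '' ball (0 : EuclideanSpace ℝ (Fin 4)) 1 = e '' ball (0 : EuclideanSpace ℝ
      (Fin 4)) 2 := by
    rw [image_comp]
    congr 1
    ext y
    simp only [mem_image, mem_ball_zero_iff]
    constructor
    · rintro ⟨z, hz, rfl⟩
      show ‖(2 : ℝ) • z‖ < 2
      rw [norm_smul, Real.norm_two]
      linarith
    · intro hy
      refine ⟨(2 : ℝ)⁻¹ • y, ?_, ?_⟩
      · rw [norm_smul, norm_inv, Real.norm_two]
        linarith
      · show (2 : ℝ) • ((2 : ℝ)⁻¹ • y) = y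
        simp [smul_smul]
  have h2' : IsPreconnected (e '' ball (0 : EuclideanSpace ℝ (Fin 4)) 2)ᶜ := by
    rw [← himage]
    exact h2.isConnected.isPreconnected
  have h3 : IsPreconnected (e '' (closedBall (0 : EuclideanSpace ℝ (Fin 4)) 1)ᶜ) :=
    (Literature.Topology.FourManifolds.isPreconnected_compl_closedBall_zero (n := 4) (by
        norm_num) 1).image
      e hE.contMDiff.continuous.continuousOn
  have hunion : (e '' closedBall (0 : EuclideanSpace ℝ (Fin 4)) 1)ᶜ = (e '' ball (0 :
      EuclideanSpace ℝ (Fin 4)) 2)ᶜ ∪ e '' (closedBall (0 : EuclideanSpace ℝ (Fin 4)) 1)ᶜ := by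
    apply Subset.antisymm
    · intro x hx
      by_cases hxr : x ∈ range e
      · obtain ⟨y, rfl⟩ := hxr
        exact Or.inr ⟨y, fun hy => hx ⟨y, hy, rfl⟩, rfl⟩
      · exact Or.inl fun ⟨y, _, hyx⟩ => hxr ⟨y, hyx⟩
    · rintro x (hx | ⟨y, hy, rfl⟩)
      · exact compl_subset_compl.2 (image_mono (closedBall_subset_ball (by norm_num))) hx
      · rintro ⟨z, hz, hzy⟩
        rw [hE.isEmbedding.injective hzy] at hz
        exact hy hz
  rw [hunion]
  set u₀ : EuclideanSpace ℝ (Fin 4) := EuclideanSpace.single 0 1 with hu₀def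
  have hu₀ : ‖u₀‖ = 1 := by simp [hu₀def]
  refine IsPreconnected.union (e ((3 : ℝ) • u₀)) ?_ ?_ h2' h3
  · rintro ⟨z, hz, hze⟩
    rw [hE.isEmbedding.injective hze, mem_ball_zero_iff, norm_smul, hu₀] at hz
    norm_num at hz
  · refine ⟨(3 : ℝ) • u₀, ?_, rfl⟩
    rw [mem_compl_iff, mem_closedBall_zero_iff, norm_smul, hu₀]
    norm_num

/-- **`F` is injective on `(e(B̄⁴))ᶜ`** (sheet counting): the restriction
`(e(B̄⁴))ᶜ → B_r(c)` of `F` is a proper local homeomorphism with finite fibres, hence a covering map,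
from a connected space onto the simply connected ball, hence injective. -/
theorem injOn_compl_image_closedBall (hE : Manifold.IsSmoothEmbedding (𝓡 4) (𝓡 4) ∞ e)
    (hF : ∀ x, x ∉ e '' ball (0 : EuclideanSpace ℝ (Fin 4)) 1 → IsLocalDiffeomorphAt (𝓡 4) (𝓡 4) ∞
        F x)
    {c : EuclideanSpace ℝ (Fin 4)} {r : ℝ} (hr : 0 < r) (hround : ∀ u : EuclideanSpace ℝ (Fin 4),
        ‖u‖ = 1 → dist (F (e u)) c = r) :
    InjOn F (e '' closedBall (0 : EuclideanSpace ℝ (Fin 4)) 1)ᶜ := by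
  set Δ := (e '' ball (0 : EuclideanSpace ℝ (Fin 4)) 1)ᶜ with hΔ
  set Δ' := (e '' closedBall (0 : EuclideanSpace ℝ (Fin 4)) 1)ᶜ with hΔ'
  have hΔ'open : IsOpen Δ' := (isClosed_image_closedBall S hE).isOpen_compl
  have hsub : Δ' ⊆ Δ := compl_image_closedBall_subset S
  have himg : F '' Δ' = ball c r :=
    (image_compl_closedBall_subset_ball S hE hF hr hround).antisymm
      (ball_subset_image_compl_closedBall S hE hF hr hround)
  have hmaps : MapsTo F Δ' (ball c r) := (mapsTo_image F Δ').mono_right himg.subset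
  set p : Δ' → ball c r := hmaps.restrict F Δ' (ball c r) with hp
  have hlocOn : IsLocalHomeomorphOn F Δ' :=
    IsLocalDiffeomorphOn.isLocalHomeomorphOn (I := 𝓡 4) (J := 𝓡 4) (n := ∞)
      fun x : Δ' => hF x (hsub x.2)
  have hlocF : IsLocalHomeomorph (Δ'.restrict F) := isLocalHomeomorph_restrict hΔ'open hlocOn
  have hpcont : Continuous p := continuous_induced_rng.2 hlocF.continuous
  have hploc : IsLocalHomeomorph p :=
    IsLocalHomeomorph.of_comp (f := p) (g := (Subtype.val : ball c r → (EuclideanSpace ℝ (Fin 4))))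
        (by exact hlocF)
      isOpen_ball.isOpenEmbedding_subtypeVal.isLocalHomeomorph hpcont
  haveI : LocallyCompactSpace (ball c r) :=
      isOpen_ball.isOpenEmbedding_subtypeVal.locallyCompactSpace
  have hproper : IsProperMap p := by
    rw [isProperMap_iff_isCompact_preimage]
    refine ⟨hpcont, fun K hK => ?_⟩
    rw [Topology.IsInducing.subtypeVal.isCompact_iff]
    have hK' : IsCompact ((Subtype.val : ball c r → (EuclideanSpace ℝ (Fin 4))) '' K) := hK.image
        continuous_subtype_val
    have heq : (Subtype.val : Δ' → S.carrier) '' (p ⁻¹' K) =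
        Δ ∩ F ⁻¹' ((Subtype.val : ball c r → (EuclideanSpace ℝ (Fin 4))) '' K) := by
      apply Subset.antisymm
      · rintro _ ⟨x, hx, rfl⟩
        exact ⟨hsub x.2, ⟨p x, hx, rfl⟩⟩
      · rintro x ⟨hxΔ, ⟨y, hyK, hyx⟩⟩
        have hxΔ' : x ∈ Δ' := by
          rcases mem_compl_image_ball S hxΔ with h | ⟨u, hu, rfl⟩
          · exact h
          · exfalso
            have h1 := hround u (mem_sphere_zero_iff_norm.1 hu)
            have h2 : dist (F (e u)) c < r := by
              rw [← hyx]
              exact mem_ball.1 y.2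
            exact h2.ne h1
        refine ⟨⟨x, hxΔ'⟩, ?_, rfl⟩
        show p ⟨x, hxΔ'⟩ ∈ K
        convert hyK
        exact Subtype.ext hyx.symm
    rw [heq]
    exact ((continuousOn_compl_image_ball S hF).preimage_isClosed_of_isClosed
      (isOpen_image_ball S hE).isClosed_compl hK'.isClosed).isCompact
  have hfin : ∀ y ∈ (univ : Set (ball c r)), (p ⁻¹' {y}).Finite := fun y _ =>
    (hproper.isCompact_preimage isCompact_singleton).finite
      (IsDiscrete.of_openPartialHomeomorph p subset_rfl fun x _ =>
        let ⟨φ, hx, hφ⟩ := hploc x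
        ⟨φ, hx, hφ.symm⟩)
  have hcov : IsCoveringMap p := isCoveringMap_iff_isCoveringMapOn_univ.2
    (hproper.isClosedMap.isCoveringMapOn_of_isLocalHomeomorphOn hfin hploc.isLocalHomeomorphOn)
  haveI : PreconnectedSpace Δ' :=
    Subtype.preconnectedSpace (isPreconnected_compl_image_closedBall S hE)
  haveI : Nonempty Δ' := by
    refine ⟨⟨e ((2 : ℝ) • EuclideanSpace.single 0 1), ?_⟩⟩
    rintro ⟨v, hv, hve⟩
    rw [hE.isEmbedding.injective hve, mem_closedBall_zero_iff, norm_smul] at hv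
    norm_num at hv
  haveI : ContractibleSpace (ball c r) := (convex_ball c r).contractibleSpace ⟨c, mem_ball_self hr⟩
  haveI : LocallyPathConnectedSpace (ball c r) := isOpen_ball.locallyPathConnectedSpace
  have hpinj : Injective p := injective_of_isCoveringMap hcov
  intro x hx x' hx' hxx'
  have key := hpinj (Subtype.ext hxx' : p ⟨x, hx⟩ = p ⟨x', hx'⟩)
  exact congrArg Subtype.val key

/-- **Sheet counting for a round crease**: `F` is injective on the whole fake ball
`Δ_e = (e(B̊⁴))ᶜ` (interior points go to the open ball, boundary points to the round sphere, and
`F ∘ e` is injective on the unit sphere by `injOn_comp_sphere`). -/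
theorem injOn_compl_image_ball (hE : Manifold.IsSmoothEmbedding (𝓡 4) (𝓡 4) ∞ e)
    (hF : ∀ x, x ∉ e '' ball (0 : EuclideanSpace ℝ (Fin 4)) 1 → IsLocalDiffeomorphAt (𝓡 4) (𝓡 4) ∞
        F x)
    {c : EuclideanSpace ℝ (Fin 4)} {r : ℝ} (hround : ∀ u : EuclideanSpace ℝ (Fin 4), ‖u‖ = 1 → dist
        (F (e u)) c = r) :
    InjOn F (e '' ball (0 : EuclideanSpace ℝ (Fin 4)) 1)ᶜ := by
  have hr := radius_pos S hE hF hround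
  obtain ⟨hinjS, -⟩ := injOn_comp_sphere S hE hF hround
  have hinj' := injOn_compl_image_closedBall S hE hF hr hround
  have hball := image_compl_closedBall_subset_ball S hE hF hr hround
  intro x hx x' hx' h
  rcases mem_compl_image_ball S hx with h1 | ⟨u, hu, rfl⟩ <;>
    rcases mem_compl_image_ball S hx' with h2 | ⟨u', hu', rfl⟩
  · exact hinj' h1 h2 h
  · have a := hball (mem_image_of_mem F h1)
    rw [h, mem_ball] at a
    exact absurd (hround u' (mem_sphere_zero_iff_norm.1 hu')) a.ne
  · have a := hball (mem_image_of_mem F h2)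
    rw [← h, mem_ball] at a
    exact absurd (hround u (mem_sphere_zero_iff_norm.1 hu)) a.ne
  · exact congrArg e (hinjS hu hu' h)

/-- The image of the fake ball is the closed round ball: `F(Δ_e) = B̄_r(c)`. -/
theorem image_compl_image_ball_eq (hE : Manifold.IsSmoothEmbedding (𝓡 4) (𝓡 4) ∞ e)
    (hF : ∀ x, x ∉ e '' ball (0 : EuclideanSpace ℝ (Fin 4)) 1 → IsLocalDiffeomorphAt (𝓡 4) (𝓡 4) ∞
        F x)
    {c : EuclideanSpace ℝ (Fin 4)} {r : ℝ} (hround : ∀ u : EuclideanSpace ℝ (Fin 4), ‖u‖ = 1 → dist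
        (F (e u)) c = r) :
    F '' (e '' ball (0 : EuclideanSpace ℝ (Fin 4)) 1)ᶜ = closedBall c r := by
  have hr := radius_pos S hE hF hround
  refine (image_compl_ball_subset_closedBall S hE hF hr hround).antisymm fun y hy => ?_
  rcases (mem_closedBall.1 hy).lt_or_eq with h | h
  · exact image_mono (compl_image_closedBall_subset S)
      (ball_subset_image_compl_closedBall S hE hF hr hround (mem_ball.2 h))
  · obtain ⟨-, himS⟩ := injOn_comp_sphere S hE hF hround
    have : y ∈ (F ∘ e) '' sphere (0 : EuclideanSpace ℝ (Fin 4)) 1 := by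
      rw [himS]
      exact mem_sphere.2 h
    obtain ⟨u, hu, rfl⟩ := this
    exact ⟨e u, image_sphere_subset S hE ⟨u, hu, rfl⟩, rfl⟩

/-- The image of the interior of the fake ball is the open round ball: `F((e(B̄⁴))ᶜ) = B_r(c)`. -/
theorem image_compl_image_closedBall_eq (hE : Manifold.IsSmoothEmbedding (𝓡 4) (𝓡 4) ∞ e)
    (hF : ∀ x, x ∉ e '' ball (0 : EuclideanSpace ℝ (Fin 4)) 1 → IsLocalDiffeomorphAt (𝓡 4) (𝓡 4) ∞
        F x)
    {c : EuclideanSpace ℝ (Fin 4)} {r : ℝ} (hround : ∀ u : EuclideanSpace ℝ (Fin 4), ‖u‖ = 1 → dist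
        (F (e u)) c = r) :
    F '' (e '' closedBall (0 : EuclideanSpace ℝ (Fin 4)) 1)ᶜ = ball c r :=
  have hr := radius_pos S hE hF hround
  (image_compl_closedBall_subset_ball S hE hF hr hround).antisymm
    (ball_subset_image_compl_closedBall S hE hF hr hround)

end Summit.SmoothPoincare4.SmoothPoincare4.Theorems.EuclideanOrigami.RoundCreaseStandard

end
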